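import Summits.CriticalPhenomena.PercolationContinuityZ3.Theorems.PercNearOneGluingNoHeavyLowerTailPcovJ1World
import Summits.CriticalPhenomena.PercolationContinuityZ3.Theorems.PercNearOneGluingNoHeavyLowerTailPcovJ1StarOne
import Summits.CriticalPhenomena.PercolationContinuityZ3.Theorems.PercNearOneGluingNoHeavyLowerTailKnQuestion8PocketBase
import HarnessLib

/-!
# KN Question 8 at `|A| = 3`, covariance side (J1): the DISJOINT-SOURCES BASE `(★₁) × (T2)` in the world framework

Support file (`--supports stmt-CriticalPhenomena-4575`, closed crux; independent mathematics on Kozma–Nitzan's Question 8 at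
`|A| = 3`), prover `prim-hp-7` (gen 39).  No named facts, no sorries; standard axioms.
Memo `prim-ineq-gen-6/FINDING-G13.md` §8(iii) ("J1 ⟸ its disjoint base ⟸ (★₁) ∧ T2") and `PROOF-STAR1.md` §4; Lean plan (L3) there.

The hypothesis `hbase` of `CovTau.metaA2_abstract` for the four functionals `(⟨e⟩, ⟨h₁⟩, ⟨α⟩, ⟨A⟩) =
(CovTau.Eav · {x} o v, CovTau.Yw · x (PcovJ1.Hw …), PcovJ1.Aw, CovTau.Yw · x (CovTau.Bf · x o Ψ))` of the J1 route
(file `…PcovJ1World.lean`): in every world `G[U']`, for DISJOINT source sets `N ∩ N' = ∅`,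

  `⟨e⟩_N · ⟨h₁⟩_{N'} ≤ ⟨α⟩_{N ∪ N'} · A`,   `A = Cov_{G[U']}(Ψ(C_x), 1{x ↔ o})`      (`PcovJ1.base`).

PROOF.  Dictionary `G[U'] ↔ coordinates pairsIn U'` (`CovTauStarN.sum_weight_restrict`): `⟨e⟩_N`, `⟨α⟩`, `⟨h₁⟩ = H2w` and `A` become
the `ED`-quantities of `…PcovJ1StarOne.lean` (`PcovJ1.Eav_eq_ED`, `PcovJ1.Aw_eq_ED`, `PcovJ1.H2w_eq_h1ED`, `CovTauStarN.Bf_eq_covOff`);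
then THEOREM (★₁) (`PcovJ1.starOne_ED`, with the pocket-avoid set `Z ∪ N'`) and the pocket base inequality (T2)
(`PocketCert.pocket_base`, here transported to `ED` form: `PcovJ1.pocketBase_ED`, pocket family `{W | W ∩ Z = ∅}`) combine linearly:
`e_N·α'·H ≤ e_∅·α_{N∪N'}·H ≤ α'·α_{N∪N'}·A` with `α' = μ(v ↮ x ∪ N', o ↮ Z ∪ N')`, and one divides by `α'` (if `α' = 0`, (★₁) gives
`e_∅ H ≤ 0`, hence `e_N H ≤ 0`).
[cite: VandenbergHaggstromKahn2005, Thm. 1.1 (pp. 3–5), Thm. 2.1 (p. 9)] [cite: Gladkov2024, Thm. 3.2 (p. 4)]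
[cite: KozmaNitzan2024, Question 8 (§5.5 p. 36)]
-/

noncomputable section

namespace Summit.CriticalPhenomena.PercolationContinuityZ3.Theorems

namespace PcovJ1

open Finset MeasureTheory Literature.Probability.Percolation Literature.Probability.Percolation.DecisionTree
open Literature.Probability.Percolation.BHK2006 (weight edgesIn rC rD weight_nonneg ind_inter)
open Literature.Probability.LatticeModels (prodBernoulli)
open SetClusterExploration TreeHarris CovTauStarN CovTau
open scoped Classical

variable {V : Type*} [Fintype V] [DecidableEq V]

/-! ### The events of `⟨e⟩_N` and `⟨α⟩` on finite configurations -/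

/-- The event `{v ↔ o} ∩ {v ↮ x} ∩ {v ↮ N}` of `⟨e⟩_N`. [cite: KozmaNitzan2024, Question 8 (§5.5 p. 36)] -/
def eSetN (x o v : V) (N : Set V) : Set (Finset (Sym2 V)) :=
  {L | (openGraph (↑L : Set (Sym2 V))).Reachable v o ∧ ¬ (openGraph (↑L : Set (Sym2 V))).Reachable v x ∧
    ∀ u ∈ N, ¬ (openGraph (↑L : Set (Sym2 V))).Reachable v u}

/-- The event `{v ↮ x} ∩ {v ↮ N} ∩ {o ↮ N} ∩ {o ↮ Zs}` of `⟨α⟩` (source set `N`, pocket-avoid set `Zs`).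
[cite: KozmaNitzan2024, Question 8 (§5.5 p. 36)] -/
def alphaSet (x o v : V) (N Zs : Set V) : Set (Finset (Sym2 V)) :=
  {L | ¬ (openGraph (↑L : Set (Sym2 V))).Reachable v x ∧ (∀ u ∈ N, ¬ (openGraph (↑L : Set (Sym2 V))).Reachable v u) ∧
    (∀ u ∈ N, ¬ (openGraph (↑L : Set (Sym2 V))).Reachable o u) ∧ ∀ z ∈ Zs, ¬ (openGraph (↑L : Set (Sym2 V))).Reachable o z}

omit [Fintype V] [DecidableEq V] in
/-- `eSetN x o v ∅` is the event `eSet x o v` of `…PcovJ1StarOne.lean`. [folklore] -/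
theorem mem_eSetN_empty_iff (x o v : V) (K : Finset (Sym2 V)) : K ∈ eSetN x o v ∅ ↔ K ∈ eSet x o v := by
  simp only [eSetN, eSet, Set.mem_setOf_eq, Set.mem_empty_iff_false, false_imp_iff, imp_true_iff, and_true]
  constructor
  · rintro ⟨h1, h2⟩
    exact ⟨fun h => h2 (h.trans h1.symm).symm, fun h => h2 h.symm, h1.symm⟩
  · rintro ⟨-, h2, h3⟩
    exact ⟨h3.symm, fun h => h2 h.symm⟩

omit [DecidableEq V] in
/-- `alphaSet x o v N' Z` is the avoidance event `aevSet x o v N' (Z ∪ N')` of `…PcovJ1MarkerDT.lean`. [folklore] -/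
theorem mem_alphaSet_iff_aevSet (x o v : V) (N' Z : Set V) (K : Finset (Sym2 V)) :
    K ∈ alphaSet x o v N' Z ↔ K ∈ aevSet x o v (srcF N') (srcF (Z ∪ N')) := by
  simp only [alphaSet, aevSet, Set.mem_setOf_eq, mem_srcF, Set.mem_union]
  constructor
  · rintro ⟨h1, h2, h3, h4⟩
    refine ⟨fun h => h1 h.symm, fun s hs h => h2 s hs h.symm, fun z hz => ?_⟩
    rcases hz with hz | hz
    exacts [h4 z hz, h3 z hz]
  · rintro ⟨h1, h2, h3⟩
    exact ⟨fun h => h1 h.symm, fun u hu h => h2 u hu h.symm, fun u hu => h3 u (Or.inr hu), fun z hz => h3 z (Or.inl hz)⟩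

/-! ### (T2) in `ED` form -/

/-- **(T2), the pocket base inequality, in `ED` form** (from `PocketCert.pocket_base` with the down-closed pocket family
`{W | W ∩ Zs = ∅}`, `x ∈ Zs`): `μ(e_N)·μ(α_{N'}) ≤ μ(e_∅)·μ(α_{N ∪ N'})`.
[cite: VandenbergHaggstromKahn2005, Thm. 2.1 (p. 9)] [cite: KozmaNitzan2024, Question 8 (§5.5 p. 36)] -/
theorem pocketBase_ED (D : Finset (Sym2 V)) {p : Sym2 V → ℝ} (hp0 : ∀ e, 0 ≤ p e) (hp1 : ∀ e, p e ≤ 1) (x o v : V)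
    (Zs : Set V) (hxZ : x ∈ Zs) (N N' : Set V) :
    ED D p (ind (eSetN x o v N)) * ED D p (ind (alphaSet x o v N' Zs)) ≤
      ED D p (ind (eSetN x o v ∅)) * ED D p (ind (alphaSet x o v (N ∪ N') Zs)) := by
  obtain ⟨w, hwD, hwD'⟩ := exists_weights_ext D hp0 hp1
  have hED : ∀ φ : Finset (Sym2 V) → ℝ, ED Finset.univ (fun e => (w e : ℝ)) φ = ED D p φ :=
    fun φ => ED_univ_eq_ED_of_zero D p _ hwD hwD' φ
  have h𝒟 : IsLowerSet {W : Set V | ∀ z ∈ Zs, z ∉ W} :=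
    fun W W' hle hW z hz hzW' => hW z hz (hle hzW')
  have key := PocketCert.pocket_base w o x v {W : Set V | ∀ z ∈ Zs, z ∉ W} h𝒟 (fun W hW hxW => hW x hxZ hxW) N N'
  rw [measureReal_eq_ED, measureReal_eq_ED, measureReal_eq_ED, measureReal_eq_ED] at key
  simp only [hED] at key
  have e1 : ∀ M : Set V, ED D p (fun K => ind (openConn v o ∩ {ω : BondConfig V | ¬ (openGraph ω).Reachable v x} ∩
      {ω | ∀ u ∈ M, ¬ (openGraph ω).Reachable v u}) (↑K : Set (Sym2 V))) = ED D p (ind (eSetN x o v M)) :=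
    fun M => ED_congr_on D p fun K _ => BystanderBHK.ind_congr (by
      simp only [eSetN, openConn, Set.mem_inter_iff, Set.mem_setOf_eq, and_assoc])
  have e2 : ∀ M : Set V, ED D p (fun K => ind ({ω : BondConfig V | ¬ (openGraph ω).Reachable v x} ∩
      {ω | ∀ u ∈ M, ¬ (openGraph ω).Reachable v u} ∩ {ω | ∀ u ∈ M, ¬ (openGraph ω).Reachable o u} ∩
      {ω | openCluster ω o ∈ {W : Set V | ∀ z ∈ Zs, z ∉ W}}) (↑K : Set (Sym2 V))) =
      ED D p (ind (alphaSet x o v M Zs)) :=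
    fun M => ED_congr_on D p fun K _ => BystanderBHK.ind_congr (by
      simp only [alphaSet, openCluster, Set.mem_inter_iff, Set.mem_setOf_eq, and_assoc])
  have e0 : ED D p (fun K => ind (openConn v o ∩ {ω : BondConfig V | ¬ (openGraph ω).Reachable v x})
      (↑K : Set (Sym2 V))) = ED D p (ind (eSetN x o v ∅)) :=
    ED_congr_on D p fun K _ => BystanderBHK.ind_congr (by
      simp only [eSetN, openConn, Set.mem_inter_iff, Set.mem_setOf_eq, Set.mem_empty_iff_false, false_imp_iff,
        imp_true_iff, and_true])
  rw [e1, e2, e0, e2] at key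
  exact key

/-! ### Dictionary: the world functionals as `ED`-quantities on the coordinates `pairsIn U'` -/

/-- `⟨e⟩_N = ED(1_{e_N})`. [folklore] -/
theorem Eav_eq_ED (w : Sym2 V → ℝ) (U' : Finset V) (x o v : V) (N : Set V) :
    Eav w U' {x} o v N = ED (pairsIn U') w (ind (eSetN x o v N)) := by
  unfold Eav
  rw [sum_weight_restrict w U' _ (fun ω => by
    rw [rC_inter_edgesIn, BystanderBHK.ind_congr (mem_rD_inter_edgesIn U' v ({x} ∪ N) ω)])]
  refine ED_congr_on _ w fun K hK => ?_
  have hK' := Finset.mem_powerset.1 hK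
  rw [oInd_rC, ← ind_inter]
  refine BystanderBHK.ind_congr ?_
  simp only [Set.mem_inter_iff, Set.mem_setOf_eq, rD, coe_inter_edgesIn_of_subset hK', eSetN, Set.mem_union,
    Set.mem_singleton_iff]
  constructor
  · rintro ⟨h1, h2⟩
    exact ⟨h1, h2 x (Or.inl rfl), fun u hu => h2 u (Or.inr hu)⟩
  · rintro ⟨h1, h2, h3⟩
    refine ⟨h1, fun a ha => ?_⟩
    rcases ha with rfl | ha
    exacts [h2, h3 a ha]

/-- `⟨α⟩_N = ED(1_{α_N})` when the observer is a vertex of the world. [folklore] -/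
theorem Aw_eq_ED (w : Sym2 V → ℝ) {U' : Finset V} (x : V) {o : V} (ho : o ∈ U') (v : V) (Z N : Set V) :
    Aw w U' x o v Z N = ED (pairsIn U') w (ind (alphaSet x o v N Z)) := by
  unfold Aw
  rw [sum_weight_restrict w U' _ (fun ω => by
    rw [BystanderBHK.ind_congr (mem_rD_inter_edgesIn U' v ({x} ∪ N) ω), ind_avoidAll_inter_edgesIn])]
  refine ED_congr_on _ w fun K hK => ?_
  have hK' := Finset.mem_powerset.1 hK
  rw [← ind_inter]
  refine BystanderBHK.ind_congr ?_
  simp only [Set.mem_inter_iff, mem_avoidAll_singleton, rD, Set.mem_setOf_eq, coe_inter_edgesIn_of_subset hK',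
    alphaSet, Set.mem_union, Set.mem_singleton_iff]
  constructor
  · rintro ⟨h1, -, h3⟩
    exact ⟨h1 x (Or.inl rfl), fun u hu => h1 u (Or.inr hu), fun u hu => h3 u (Or.inr hu), fun z hz => h3 z (Or.inl hz)⟩
  · rintro ⟨h1, h2, h3, h4⟩
    refine ⟨fun a ha => ?_, ho, fun a ha => ?_⟩
    · rcases ha with rfl | ha
      exacts [h1, h2 a ha]
    · rcases ha with ha | ha
      exacts [h4 a ha, h3 a ha]

/-- `srcF (insert o N) = insert o (srcF N)`. [folklore] -/
theorem srcF_insert (o : V) (N : Set V) : srcF (insert o N) = insert o (srcF N) := by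
  ext u; simp [srcF]

/-- The world covariance vanishes when the marker has been deleted: `covOff D p Ψ x v W = 0` for `v ∈ W`, `x ≠ v`
(`v` is isolated in `off W K`). [folklore] -/
theorem covOff_eq_zero_of_mem (D : Finset (Sym2 V)) (p : Sym2 V → ℝ) (Ψ : Set (Sym2 V) → ℝ) {x v : V} (hxv : x ≠ v)
    {W : Finset V} (hvW : v ∈ W) : covOff D p Ψ x v W = 0 := by
  have h0 : ∀ K : Finset (Sym2 V), hr x v (off W K) = 0 := by
    intro K
    refine ind_of_not_mem fun (h : (openGraph (↑(off W K) : Set (Sym2 V))).Reachable x v) => ?_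
    have hcl : ∀ a b, a ∈ ({u | u ≠ v} : Set V) → s(a, b) ∈ off W K → b ∈ ({u | u ≠ v} : Set V) := by
      intro a b _ hab hb
      subst hb
      exact (mem_off.1 hab).2 _ (Sym2.mem_mk_right a _) hvW
    exact (mem_of_reachable_closed hcl (show x ∈ ({u | u ≠ v} : Set V) from hxv) h) rfl
  unfold covOff
  simp only [h0, mul_zero]
  unfold ED
  simp

/-- **`⟨h₁⟩_{N'} = H2w(N')` is the pocketed marker bracket `h1ED` of `…PcovJ1MarkerDT.lean`** (source set `N'`, pocket-avoid set
`Z ∪ N'`), when `o` is a vertex of the world and `x ≠ v`. [cite: VandenbergHaggstromKahn2005, eq. (6) (p. 4)] -/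
theorem H2w_eq_h1ED (w : Sym2 V → ℝ) {U' : Finset V} {x o v : V} (ho : o ∈ U') (hxv : x ≠ v) (Z : Set V)
    (Ψ : Set V → ℝ) (N' : Set V) :
    H2w w U' x o v Z Ψ N' = h1ED (pairsIn U') w (liftΨ Ψ x) x o v (srcF N') (srcF (Z ∪ N')) := by
  unfold H2w h1ED
  rw [sum_weight_restrict w U' _ (fun ω => by
    rw [rest_inter_edgesIn, BystanderBHK.ind_congr (mem_rD_inter_edgesIn U' x N' ω), ind_avoidAll_inter_edgesIn])]
  refine ED_congr_on _ w fun K hK => ?_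
  have hK' := Finset.mem_powerset.1 hK
  rw [rest_eq_sdiff hK', srcF_insert, Bf_sdiff_eq_covOff, mul_comm]
  by_cases hv : v ∈ reached (pairsIn U') (insert o (srcF N')) K
  · -- the marker is swallowed: both integrands vanish
    rw [covOff_eq_zero_of_mem _ _ _ hxv hv, mul_zero, mul_zero]
  · congr 1
    rw [← ind_inter]
    refine BystanderBHK.ind_congr ?_
    have hv' : ∀ s ∈ insert o (srcF N'), ¬ (openGraph (↑K : Set (Sym2 V))).Reachable s v :=
      fun s hs h => hv ((mem_reached_iff' hK').2 ⟨s, hs, h⟩)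
    simp only [Set.mem_inter_iff, mem_avoidAll_singleton, rD, Set.mem_setOf_eq, coe_inter_edgesIn_of_subset hK',
      wSet, mem_srcF, Set.mem_union]
    constructor
    · rintro ⟨h1, -, h3⟩
      refine ⟨fun s hs h => h1 s hs h.symm, fun s hs => hv' s (Finset.mem_insert_of_mem (mem_srcF.2 hs)), fun z hz => ?_⟩
      rcases hz with hz | hz
      exacts [h3 z (Or.inl hz), h3 z (Or.inr hz)]
    · rintro ⟨h1, -, h3⟩
      refine ⟨fun s hs h => h1 s hs h.symm, ho, fun z hz => ?_⟩
      rcases hz with hz | hz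
      exacts [h3 z (Or.inl hz), h3 z (Or.inr hz)]

omit [DecidableEq V] in
/-- `H2w = 0` in a world not containing the observer. [folklore] -/
theorem H2w_eq_zero_of_not_mem_obs (w : Sym2 V → ℝ) {U' : Finset V} (x : V) {o : V} (ho : o ∉ U') (v : V) (Z : Set V)
    (Ψ : Set V → ℝ) (N : Set V) : H2w w U' x o v Z Ψ N = 0 :=
  Finset.sum_eq_zero fun ω _ => by
    rw [ind_of_not_mem (fun h => ho (mem_avoidAll_singleton.1 h).1 : ω ∉ avoidAll U' {o} (Z ∪ N))]; ring

/-! ### The disjoint-sources base -/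

/-- **The disjoint-sources base of the J1 induction** (FINDING-G13 §8(iii): "(★₁) in the sub-world × T2"): in every world
`G[U']`, for `N ∩ N' = ∅`, `x, v ∈ Z`, `x, o, v` pairwise distinct and `Ψ` monotone nonnegative,
`⟨e⟩_N · ⟨h₁⟩_{N'} ≤ ⟨α⟩_{N ∪ N'} · Cov_{G[U']}(Ψ(C_x), 1{x↔o})`.
[cite: VandenbergHaggstromKahn2005, Thm. 1.1 (pp. 3–5), Thm. 2.1 (p. 9)] [cite: Gladkov2024, Thm. 3.2 (p. 4)]
[cite: KozmaNitzan2024, Question 8 (§5.5 p. 36)] -/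
theorem base (w : Sym2 V → ℝ) (hw0 : ∀ e, 0 ≤ w e) (hw1 : ∀ e, w e ≤ 1) (hm : ∑ ω, weight w ω = 1)
    (U' : Finset V) {x o v : V} (hxv : x ≠ v) {Z : Set V} (hxZ : x ∈ Z) (hvZ : v ∈ Z)
    {Ψ : Set V → ℝ} (hΨ : ∀ S T : Set V, S ⊆ T → Ψ S ≤ Ψ T) (hΨ0 : ∀ S, 0 ≤ Ψ S) (N N' : Set V) :
    Eav w U' {x} o v N * Yw w U' x (Hw w x o v Z Ψ) N' ≤ Aw w U' x o v Z (N ∪ N') * Bf w U' x o Ψ := by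
  have hA0 : 0 ≤ Bf w U' x o Ψ := Bf_nonneg hw0 hw1 hm U' x o hΨ hΨ0
  have hαU0 : 0 ≤ Aw w U' x o v Z (N ∪ N') := Aw_nonneg hw0 hw1 U' x o v Z _
  have hRHS : 0 ≤ Aw w U' x o v Z (N ∪ N') * Bf w U' x o Ψ := mul_nonneg hαU0 hA0
  rw [Yw_Hw_eq w hm]
  by_cases ho : o ∈ U'
  swap
  · rw [H2w_eq_zero_of_not_mem_obs w x ho, mul_zero]; exact hRHS
  -- everything on the coordinates `D = pairsIn U'`
  set D := pairsIn U' with hD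
  have hH0 : 0 ≤ H2w w U' x o v Z Ψ N' := H2w_nonneg hw0 hw1 hm U' x o v Z hΨ hΨ0 N'
  rw [Eav_eq_ED, Aw_eq_ED w x ho, H2w_eq_h1ED w ho hxv, Bf_eq_covOff] at *
  -- names
  set e := ED D w (ind (eSetN x o v N)) with he
  set e0 := ED D w (ind (eSetN x o v ∅)) with he0
  set α' := ED D w (ind (alphaSet x o v N' Z)) with hα'
  set αU := ED D w (ind (alphaSet x o v (N ∪ N') Z)) with hαU
  set H := h1ED D w (liftΨ Ψ x) x o v (srcF N') (srcF (Z ∪ N')) with hH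
  set A := covOff D w (liftΨ Ψ x) x o ∅ with hA
  -- (T2) and (★₁)
  have hT2 : e * α' ≤ e0 * αU := pocketBase_ED D hw0 hw1 x o v Z hxZ N N'
  have hxZ' : x ∈ srcF (Z ∪ N') := mem_srcF.2 (Or.inl hxZ)
  have hvZ' : v ∈ srcF (Z ∪ N') := mem_srcF.2 (Or.inl hvZ)
  have hS1 := starOne_ED D hw0 hw1 Ψ hΨ hΨ0 x o v (srcF N') (srcF (Z ∪ N')) hxZ' hvZ'
  have eS : ED D w (ind (eSet x o v)) = e0 := ED_congr_on D w fun K _ => BystanderBHK.ind_congr (mem_eSetN_empty_iff x o v K).symm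
  have eA : ED D w (ind (aevSet x o v (srcF N') (srcF (Z ∪ N')))) = α' :=
    ED_congr_on D w fun K _ => BystanderBHK.ind_congr (mem_alphaSet_iff_aevSet x o v N' Z K).symm
  rw [eS, eA] at hS1
  -- hS1 : e0 * H ≤ α' * A
  have he_nonneg : 0 ≤ e := Finset.sum_nonneg fun K _ => mul_nonneg (wtW_nonneg D hw0 hw1 K) (ind_nonneg _ _)
  have hα'0 : 0 ≤ α' := Finset.sum_nonneg fun K _ => mul_nonneg (wtW_nonneg D hw0 hw1 K) (ind_nonneg _ _)
  have hee0 : e ≤ e0 := ED_mono D hw0 hw1 fun K _ =>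
    BHK2006.ind_mono (fun L (hL : L ∈ eSetN x o v N) => show L ∈ eSetN x o v ∅ from
      ⟨hL.1, hL.2.1, fun u hu => hu.elim⟩) K
  rcases hα'0.eq_or_lt with hα | hα
  · -- `α' = 0`: (★₁) gives `e0·H ≤ 0`, hence `e·H ≤ 0`
    have h1 : e0 * H ≤ 0 := by rw [← hα, zero_mul] at hS1; exact hS1
    have h2 : e * H ≤ e0 * H := mul_le_mul_of_nonneg_right hee0 hH0
    exact (h2.trans h1).trans hRHS
  · -- `α' > 0`: divide
    have key : α' * (e * H) ≤ α' * (αU * A) :=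
      calc α' * (e * H) = (e * α') * H := by ring
        _ ≤ (e0 * αU) * H := mul_le_mul_of_nonneg_right hT2 hH0
        _ = αU * (e0 * H) := by ring
        _ ≤ αU * (α' * A) := mul_le_mul_of_nonneg_left hS1 hαU0
        _ = α' * (αU * A) := by ring
    exact le_of_mul_le_mul_left key hα

end PcovJ1

end Summit.CriticalPhenomena.PercolationContinuityZ3.Theorems

end
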